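import Summits.Ventures.LatticeQCDFlow.Scaling.SwapLadderRoundTripOptimum
import Summits.Ventures.LatticeQCDFlow.Scaling.SwapLadderRoundTripDEO

/-!
HONEST FRAMING: exact (Metropolis-corrected) sampling algorithms for lattice gauge theory; figures
of merit are autocorrelation/cost numbers at stated couplings and volumes; no continuum-physics
claim.

# SwapLadderRoundTripDEOOptimum — UNDER THE DRIVER's DETERMINISTIC EVEN–ODD SCHEME, TOO, THE EQUAL-ACCEPTANCE
# LADDER IS THE UNIQUE MINIMISER OF THE GAUSSIAN-MODEL ROUND TRIP AMONG `K`-INTERVAL LADDERS WITH THE SAME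
# ENDPOINTS (row 22 `su3-ptbc`, GEN-5, ours; corollary of `SwapLadderRoundTripOptimum` + `SwapLadderRoundTripDEO`)

Venture `LatticeQCDFlow` (cell pub-lqcd), topic `Scaling`; FANOUT row 22.  The DEO round trip of a ladder with
model profile `a_i = gaussAcc(gap_i)` is `2(K+1)·Σ_i 1/gaussAcc(gap_i) − 2(K+1)(K−1)`
(`deo_round_trip_eq_seo_sub`), and `Σ_i 1/gaussAcc(gap_i) ≥ K/gaussAcc(Λ/K)` with equality iff all gaps are
`Λ/K` (`mul_gaussInvAcc_div_le_sum` / `_lt_sum`, strict convexity of `1/erfc`).  Nothing is cited as a fact.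

* **`deo_model_round_trip`** — `= 2(K+1)·Σ_i gaussInvAcc(gap_i) − 2(K+1)(K−1)` (monotone ladder);
* **`deo_model_round_trip_ge`** — `≥ 2(K+1)·(K·gaussInvAcc(Λ/K) − (K−1))`, the uniform ladder's DEO round trip
  (`deo_model_round_trip_uniformLadder`); **`deo_model_round_trip_gt_of_ne_uniform`** — strict unless uniform.
So CARD-su3-ptbc §1.6's equal-acceptance re-spacing rule is the fixed-`N_r` optimum of the idealised round trip
for BOTH swap schedules.  NOT CLAIMED: the optimum over `K` (scheme-dependent: `SwapAcceptanceOptimum` vs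
`SwapAcceptanceOptimumDEO`); that the model describes PTBC; any number of a run.
-/

noncomputable section

open Finset Real
open Literature.Probability.MarkovChains

namespace Summit.Ventures.LatticeQCDFlow.Scaling

variable {K : ℕ} {g : ℕ → ℝ} {h : Fin (K + 1) × Bool → Fin (K + 1) × Bool → ℝ}

/-- **The DEO model round trip of a monotone ladder**: `2(K+1)·Σ_i 1/gaussAcc(gap_i) − 2(K+1)(K−1)`. [ours] -/
theorem deo_model_round_trip (hh : IsHittingTimeSolution (deoWalk K (ladderProfile g)) h) :
    h (deoBot K) (deoTop K) + h (deoTop K) (deoBot K)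
      = 2 * ((K : ℝ) + 1) * ∑ i ∈ range K, gaussInvAcc (ladderGap g i) - 2 * ((K : ℝ) + 1) * ((K : ℝ) - 1) :=
  deo_round_trip_eq_seo_sub hh fun j => (ladderProfile_pos g j).ne'

/-- **The uniform ladder's DEO model round trip**: `2(K+1)·(K/gaussAcc(Λ/K) − (K−1))`. [ours] -/
theorem deo_model_round_trip_uniformLadder {g₀ Λ : ℝ}
    {h : Fin (K + 1) × Bool → Fin (K + 1) × Bool → ℝ}
    (hh : IsHittingTimeSolution (deoWalk K (ladderProfile (uniformLadder g₀ Λ K))) h) :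
    h (deoBot K) (deoTop K) + h (deoTop K) (deoBot K)
      = 2 * ((K : ℝ) + 1) * ((K : ℝ) * gaussInvAcc (Λ / K) - ((K : ℝ) - 1)) := by
  rw [deo_model_round_trip hh, sum_gaussInvAcc_uniformLadder]
  ring

/-- **EVERY `K`-INTERVAL LADDER's DEO MODEL ROUND TRIP IS AT LEAST THE UNIFORM LADDER's** (same endpoints,
`Λ = g K − g 0`, `K ≥ 1`). [ours] -/
theorem deo_model_round_trip_ge (hK : 0 < K) (hh : IsHittingTimeSolution (deoWalk K (ladderProfile g)) h) :
    2 * ((K : ℝ) + 1) * ((K : ℝ) * gaussInvAcc ((g K - g 0) / K) - ((K : ℝ) - 1))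
      ≤ h (deoBot K) (deoTop K) + h (deoTop K) (deoBot K) := by
  rw [deo_model_round_trip hh]
  have hJ := mul_gaussInvAcc_div_le_sum hK g
  have hK1 : (0 : ℝ) ≤ 2 * ((K : ℝ) + 1) := by positivity
  nlinarith [mul_le_mul_of_nonneg_left hJ hK1]

/-- **UNIQUENESS: a ladder with some gap `≠ Λ/K` has a STRICTLY longer DEO model round trip than the uniform
one** — the equal-acceptance ladder is the unique fixed-`K` minimiser under the driver's scheme as well. [ours] -/
theorem deo_model_round_trip_gt_of_ne_uniform (hK : 0 < K)
    (hne : ∃ i ∈ range K, ladderGap g i ≠ (g K - g 0) / K)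
    (hh : IsHittingTimeSolution (deoWalk K (ladderProfile g)) h) :
    2 * ((K : ℝ) + 1) * ((K : ℝ) * gaussInvAcc ((g K - g 0) / K) - ((K : ℝ) - 1))
      < h (deoBot K) (deoTop K) + h (deoTop K) (deoBot K) := by
  rw [deo_model_round_trip hh]
  have hJ := mul_gaussInvAcc_div_lt_sum hK g hne
  have hK1 : (0 : ℝ) < 2 * ((K : ℝ) + 1) := by positivity
  nlinarith [mul_lt_mul_of_pos_left hJ hK1]

end Summit.Ventures.LatticeQCDFlow.Scaling

end
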